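import Summits.HodgeConjecture.HodgeConjecture.Theorems.VHCAbelianSchemesRoadServedFibreAnchors
import Summits.HodgeConjecture.HodgeConjecture.Theorems.VHCAbelianSchemesRoadServedFibreAlgebraic
import Summits.HodgeConjecture.HodgeConjecture.Theses.VHCAbelianSchemesRoad
import HarnessLib

/-!
# Road b02 (`VHCAbelianSchemesRoad`, D-0059) — THE SERVED-FIBRE PARTITION ON THE ROUTE DECLS: the crux `SemiregularSheafRepresentativesTwAtDiag`
# (item 19787) from its `(4,2)` cell, an ANCHORED CARRIER statement at `(6,3)`, the `(6,3)` RESIDUAL, and the tail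

research route conditional on HC_CM; not a corollary; Q11.4-sentence-2 already refuted in dim ≥ 3.

FACT-FREE; `HC_CM` nowhere. The anchor data `(𝔄 C, 𝔖 C)` (anchor predicate on polarised varieties, served `(3,3)`-classes) is a PARAMETER and may
depend on the Chern character theory `C` (the served classes of a printed carrier are read through `C`). For the twisted door
`tw C AdmTw := twistedReflexiveClass C (gluableSigmaAdmissible ∨ bfSingleAdmissible)` of the crux:

* §1 `rung_sixfoldMiddleTw_of_anchoredCarrierAt_of_residual` — the registered rung statement `∀ C, LefAtExceptionalRegimeSixfoldMiddle (tw C AdmTw)`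
  (skeleton v2 `stub_rung_sixfoldMiddleTw`, byte-identical conclusion) from «∀ C, AnchoredCarrierAt (tw C AdmTw) 6 3 (𝔄 C) (𝔖 C)» and the residual
  «∀ C, LefAtExceptionalRegimeAtUnder (tw C AdmTw) 6 3 (¬ HasServedFibre 6 3 (𝔄 C) (𝔖 C))» — the shape of skeleton v3 (ring2 LEAD gen 151 nod N7);
  `twAtDiag_of_firstCell_of_anchoredCarrierAt_of_residual_of_tail` — THE CRUX BY NAME from the `(4,2)` cell, the two `(6,3)` pieces and the tail
  `m ≥ 4` (case split on `m`; the v3 composition over landed constants); the two-anchor-families form of the rung.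
* §2 NO SLACK the other way: the crux gives every conditional cell on the diagonal (`under_of_twAtDiag`), in particular every residual and every
  through-anchor piece, for every anchor data.
* §3 AT THE ANCHORS: the through-anchor piece at `(6,3)` alone already demands a twisted datum modulo Lefschetz classes on a copy of every anchor
  sixfold carrying a served algebraic class off `D³ ⊗ ℂ` (`exists_designModLefschetz_at_anchor_of_throughAnchor_63`, transportable anchor data);
  and the partition at `(6,3)` is NOT vacuous by hypothesis as soon as one such anchor exists (`not_forall_not_hasServedFibre_63_of_anchor`).

* §4 (appended) CELL-FREE: the route binder `TwistedPerfectDoor` ∧ an anchored carrier statement at `(6,3)` ALONE make every fibrewise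
  rational `(3,3)` class on every sixfold pencil THROUGH A SERVED ANCHOR algebraic on every fibre, and on every sixfold isomorphic to a fibre
  (`mem_algebraicClasses_of_twistedPerfectDoor_of_anchoredCarrierAt_63`, `…_through`; companion `VHCAbelianSchemesRoadServedFibreAlgebraic`) —
  the anchor-carrier stub's summit-facing content WITHOUT the residual stub (Markman's Thm. 1.5.1 mechanism in the kernel, anchor-generic).

What is NOT claimed: the crux, any cell, any anchored carrier statement, any residual, K-SR♭∃, VHC, `HC_AV`, HC; that Markman's secant anchors
(arXiv:2502.03415 Thm. 1.4.1, PREPRINT) satisfy any typed anchor predicate — that typing is the road seat's. References: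
[cite: Bloch1972Semiregularity, Remark (7.5)] [cite: BuchweitzFlenner2003, §5 Thm. 5.1] [cite: vanGeemen1994HodgeAV, §2.4 and Thm. 4.11]
[cite: Markman2025SecantWeil, Thm. 1.4.1 and Thm. 1.5.1] [cite: Pridham2024Semiregularity, Cor. 2.25 and Rem. 2.27].
-/

noncomputable section

open CategoryTheory CategoryTheory.Limits AlgebraicGeometry Topology

namespace Summit.HodgeConjecture.HodgeConjecture.Ring2.SemiregularRepresentatives

set_option linter.dupNamespace false -- the cell's namespace repeats the summit name, as in every `Ring2*` file

open Literature.AlgebraicGeometry Literature.AlgebraicGeometry.Motives Literature.AlgebraicGeometry.HodgeTheory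
open Literature.AlgebraicTopology.SingularHomology
open Literature.Barriers.HodgeConjecture (divisorClassesSpan)
open Summit.Ventures.HSemireg (ObjClass)

/-! ## §1 The `(6,3)` rung and the crux from an anchored carrier statement and its residual -/

/-- **The `(6,3)` RUNG of the road (the registered statement `∀ C, LefAtExceptionalRegimeSixfoldMiddle (tw C AdmTw)`) from an ANCHORED CARRIER
statement at `(6,3)` and its RESIDUAL**, for any anchor data `(𝔄 C, 𝔖 C)` — transport along pencils through a served fibre (PART Z-b §5) and
excluded middle. Skeleton v3's glue N7. [cite: Markman2025SecantWeil, Thm. 1.4.1 and Thm. 1.5.1] [cite: Bloch1972Semiregularity, Remark (7.5)]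
[cite: vanGeemen1994HodgeAV, Thm. 4.11] -/
theorem rung_sixfoldMiddleTw_of_anchoredCarrierAt_of_residual
    (𝔄 : ChernCharacterBetti → ∀ X : SchemeOver ℂ, complexBetti X 2 → Prop)
    (𝔖 : ChernCharacterBetti → ∀ X : SchemeOver ℂ, complexBetti X 2 → Set (complexBetti X (2 * 3)))
    (hA : ∀ C : ChernCharacterBetti,
      AnchoredCarrierAt (Literature.AlgebraicGeometry.HodgeTheory.twistedReflexiveClass C
        (fun n X₀ I E => Summit.Ventures.HSemireg.gluableSigmaAdmissible n X₀ I E ∨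
          Literature.AlgebraicGeometry.HodgeTheory.bfSingleAdmissible n X₀ I E)) 6 3 (𝔄 C) (𝔖 C))
    (hR : ∀ C : ChernCharacterBetti,
      LefAtExceptionalRegimeAtUnder (Literature.AlgebraicGeometry.HodgeTheory.twistedReflexiveClass C
        (fun n X₀ I E => Summit.Ventures.HSemireg.gluableSigmaAdmissible n X₀ I E ∨
          Literature.AlgebraicGeometry.HodgeTheory.bfSingleAdmissible n X₀ I E)) 6 3
        (fun _ _ f W ↦ ¬ HasServedFibre 6 3 (𝔄 C) (𝔖 C) f W)) :
    ∀ C : ChernCharacterBetti, LefAtExceptionalRegimeSixfoldMiddle (Literature.AlgebraicGeometry.HodgeTheory.twistedReflexiveClass C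
      (fun n X₀ I E => Summit.Ventures.HSemireg.gluableSigmaAdmissible n X₀ I E ∨
        Literature.AlgebraicGeometry.HodgeTheory.bfSingleAdmissible n X₀ I E)) :=
  fun C ↦ lefAtExceptionalRegimeSixfoldMiddle_of_anchoredCarrierAt_of_under_not (hA C) (hR C)

/-- **THE CRUX `SemiregularSheafRepresentativesTwAtDiag` (item 19787) BY NAME from the `(4,2)` cell, an anchored carrier statement at `(6,3)`,
the `(6,3)` residual, and the tail `m ≥ 4`** — the composition of skeleton v3 (stubs (4,2) ∕ anchor carrier ∕ residual ∕ tail), over landed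
constants; case split on `m`. [cite: Bloch1972Semiregularity, Remark (7.5)] [cite: Markman2025SecantWeil, Thm. 1.4.1 and Thm. 1.5.1]
[cite: vanGeemen1994HodgeAV, §2.4 and Thm. 4.11] -/
theorem twAtDiag_of_firstCell_of_anchoredCarrierAt_of_residual_of_tail
    (𝔄 : ChernCharacterBetti → ∀ X : SchemeOver ℂ, complexBetti X 2 → Prop)
    (𝔖 : ChernCharacterBetti → ∀ X : SchemeOver ℂ, complexBetti X 2 → Set (complexBetti X (2 * 3)))
    (h₁ : ∀ C : ChernCharacterBetti,
      LefAtExceptionalRegimeAt (Literature.AlgebraicGeometry.HodgeTheory.twistedReflexiveClass C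
        (fun n X₀ I E => Summit.Ventures.HSemireg.gluableSigmaAdmissible n X₀ I E ∨
          Literature.AlgebraicGeometry.HodgeTheory.bfSingleAdmissible n X₀ I E)) 4 2)
    (hA : ∀ C : ChernCharacterBetti,
      AnchoredCarrierAt (Literature.AlgebraicGeometry.HodgeTheory.twistedReflexiveClass C
        (fun n X₀ I E => Summit.Ventures.HSemireg.gluableSigmaAdmissible n X₀ I E ∨
          Literature.AlgebraicGeometry.HodgeTheory.bfSingleAdmissible n X₀ I E)) 6 3 (𝔄 C) (𝔖 C))
    (hR : ∀ C : ChernCharacterBetti,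
      LefAtExceptionalRegimeAtUnder (Literature.AlgebraicGeometry.HodgeTheory.twistedReflexiveClass C
        (fun n X₀ I E => Summit.Ventures.HSemireg.gluableSigmaAdmissible n X₀ I E ∨
          Literature.AlgebraicGeometry.HodgeTheory.bfSingleAdmissible n X₀ I E)) 6 3
        (fun _ _ f W ↦ ¬ HasServedFibre 6 3 (𝔄 C) (𝔖 C) f W))
    (h₃ : ∀ (C : ChernCharacterBetti) (m : ℕ), 4 ≤ m →
      LefAtExceptionalRegimeAt (Literature.AlgebraicGeometry.HodgeTheory.twistedReflexiveClass C
        (fun n X₀ I E => Summit.Ventures.HSemireg.gluableSigmaAdmissible n X₀ I E ∨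
          Literature.AlgebraicGeometry.HodgeTheory.bfSingleAdmissible n X₀ I E)) (2 * m) m) :
    Theses.VHCAbelianSchemesRoad.SemiregularSheafRepresentativesTwAtDiag := by
  intro C m hm
  rcases Nat.lt_or_ge m 4 with hlt | hge
  · interval_cases m
    · exact h₁ C
    · exact lefAtExceptionalRegimeAt_of_anchoredCarrierAt_of_under_not (hA C) (hR C)
  · exact h₃ C m hge

/-- **The `(6,3)` rung with TWO anchor families** (room for a second printed carrier family next to Markman's secant anchors — e.g. one
serving presently unserved anchor directions, finding F1): two anchored carrier statements and the JOINT residual (pencils served by neither)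
give the rung. [cite: Markman2025SecantWeil, Thm. 1.4.1] [cite: Bloch1972Semiregularity, Remark (7.5)] [cite: vanGeemen1994HodgeAV, Thm. 4.11] -/
theorem rung_sixfoldMiddleTw_of_two_anchoredCarrierAt_of_residual
    (𝔄₁ 𝔄₂ : ChernCharacterBetti → ∀ X : SchemeOver ℂ, complexBetti X 2 → Prop)
    (𝔖₁ 𝔖₂ : ChernCharacterBetti → ∀ X : SchemeOver ℂ, complexBetti X 2 → Set (complexBetti X (2 * 3)))
    (hA₁ : ∀ C : ChernCharacterBetti,
      AnchoredCarrierAt (Literature.AlgebraicGeometry.HodgeTheory.twistedReflexiveClass C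
        (fun n X₀ I E => Summit.Ventures.HSemireg.gluableSigmaAdmissible n X₀ I E ∨
          Literature.AlgebraicGeometry.HodgeTheory.bfSingleAdmissible n X₀ I E)) 6 3 (𝔄₁ C) (𝔖₁ C))
    (hA₂ : ∀ C : ChernCharacterBetti,
      AnchoredCarrierAt (Literature.AlgebraicGeometry.HodgeTheory.twistedReflexiveClass C
        (fun n X₀ I E => Summit.Ventures.HSemireg.gluableSigmaAdmissible n X₀ I E ∨
          Literature.AlgebraicGeometry.HodgeTheory.bfSingleAdmissible n X₀ I E)) 6 3 (𝔄₂ C) (𝔖₂ C))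
    (hR : ∀ C : ChernCharacterBetti,
      LefAtExceptionalRegimeAtUnder (Literature.AlgebraicGeometry.HodgeTheory.twistedReflexiveClass C
        (fun n X₀ I E => Summit.Ventures.HSemireg.gluableSigmaAdmissible n X₀ I E ∨
          Literature.AlgebraicGeometry.HodgeTheory.bfSingleAdmissible n X₀ I E)) 6 3
        (fun _ _ f W ↦ ¬ HasServedFibre 6 3 (𝔄₁ C) (𝔖₁ C) f W ∧ ¬ HasServedFibre 6 3 (𝔄₂ C) (𝔖₂ C) f W)) :
    ∀ C : ChernCharacterBetti, LefAtExceptionalRegimeSixfoldMiddle (Literature.AlgebraicGeometry.HodgeTheory.twistedReflexiveClass C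
      (fun n X₀ I E => Summit.Ventures.HSemireg.gluableSigmaAdmissible n X₀ I E ∨
        Literature.AlgebraicGeometry.HodgeTheory.bfSingleAdmissible n X₀ I E)) :=
  fun C ↦ lefAtExceptionalRegimeSixfoldMiddle_iff_at.2
    (lefAtExceptionalRegimeAt_of_under_of_under_of_under_not_not (under_hasServedFibre_of_anchoredCarrierAt (hA₁ C))
      (under_hasServedFibre_of_anchoredCarrierAt (hA₂ C)) (hR C))

/-! ## §2 No slack the other way: the crux gives every conditional diagonal cell -/

/-- **The crux gives every conditional cell on the diagonal** — in particular every residual and every through-anchor piece, for every anchor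
data (so the partition loses nothing). [cite: Bloch1972Semiregularity, Remark (7.5)] [cite: vanGeemen1994HodgeAV, §2.4] -/
theorem under_of_twAtDiag (h : Theses.VHCAbelianSchemesRoad.SemiregularSheafRepresentativesTwAtDiag) (C : ChernCharacterBetti) (m : ℕ)
    (hm : 2 ≤ m) (P : ∀ ⦃𝒳 S : SchemeOver ℂ⦄, (𝒳 ⟶ S) → complexBetti 𝒳 (2 * m) → Prop) :
    LefAtExceptionalRegimeAtUnder (Literature.AlgebraicGeometry.HodgeTheory.twistedReflexiveClass C
      (fun n X₀ I E => Summit.Ventures.HSemireg.gluableSigmaAdmissible n X₀ I E ∨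
        Literature.AlgebraicGeometry.HodgeTheory.bfSingleAdmissible n X₀ I E)) (2 * m) m P :=
  under_of_lefAtExceptionalRegimeAt P (h C m hm)

/-- **The registered rung gives the `(6,3)` residual and the `(6,3)` through-anchor piece of any anchor data** (no slack).
[cite: Bloch1972Semiregularity, Remark (7.5)] [cite: Markman2025SecantWeil, Thm. 1.5.1] -/
theorem under_63_of_rung_sixfoldMiddleTw {C : ChernCharacterBetti}
    (h : LefAtExceptionalRegimeSixfoldMiddle (Literature.AlgebraicGeometry.HodgeTheory.twistedReflexiveClass C
      (fun n X₀ I E => Summit.Ventures.HSemireg.gluableSigmaAdmissible n X₀ I E ∨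
        Literature.AlgebraicGeometry.HodgeTheory.bfSingleAdmissible n X₀ I E)))
    (P : ∀ ⦃𝒳 S : SchemeOver ℂ⦄, (𝒳 ⟶ S) → complexBetti 𝒳 (2 * 3) → Prop) :
    LefAtExceptionalRegimeAtUnder (Literature.AlgebraicGeometry.HodgeTheory.twistedReflexiveClass C
      (fun n X₀ I E => Summit.Ventures.HSemireg.gluableSigmaAdmissible n X₀ I E ∨
        Literature.AlgebraicGeometry.HodgeTheory.bfSingleAdmissible n X₀ I E)) 6 3 P :=
  under_of_lefAtExceptionalRegimeAt P (lefAtExceptionalRegimeSixfoldMiddle_iff_at.1 h)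

/-! ## §3 At the anchors: what the `(6,3)` through-anchor piece alone demands; non-vacuity -/

/-- **THE `(6,3)` THROUGH-ANCHOR PIECE ALONE DEMANDS A TWISTED DATUM MODULO LEFSCHETZ CLASSES ON A COPY OF EVERY ANCHOR SIXFOLD** carrying a
served rational algebraic class `w ∉ D³ ⊗ ℂ` (anchor data transportable along isomorphisms; anchors `≅` abelian sixfolds with `θ` rational
`(1,1)`): some copy `e : X' ≅ X` carries `(I ∋ 3, κ)` in the twisted door with `κ₃ = e^*(a·w + z)`, `a ≠ 0`, `z` algebraic Lefschetz, sides
`(3,3)`… of type `(q,q)`. The anchor-carrier stub of skeleton v3 is thus NECESSARY for its glue piece modulo the sandwich's slack.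
[cite: Bloch1972Semiregularity, Remark (7.5)] [cite: vanGeemen1994HodgeAV, §2.4 and Thm. 4.11] [cite: Markman2025SecantWeil, Thm. 1.4.1] -/
theorem exists_designModLefschetz_at_anchor_of_throughAnchor_63 {C : ChernCharacterBetti}
    {𝔄 : ∀ X : SchemeOver ℂ, complexBetti X 2 → Prop} {𝔖 : ∀ X : SchemeOver ℂ, complexBetti X 2 → Set (complexBetti X (2 * 3))}
    (h : LefAtExceptionalRegimeAtUnder (Literature.AlgebraicGeometry.HodgeTheory.twistedReflexiveClass C
      (fun n X₀ I E => Summit.Ventures.HSemireg.gluableSigmaAdmissible n X₀ I E ∨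
        Literature.AlgebraicGeometry.HodgeTheory.bfSingleAdmissible n X₀ I E)) 6 3 (HasServedFibre 6 3 𝔄 𝔖))
    (htr : ∀ ⦃X X' : SchemeOver ℂ⦄ (e : X ≅ X') (θ : complexBetti X 2) (w : complexBetti X (2 * 3)), 𝔄 X θ → w ∈ 𝔖 X θ →
      𝔄 X' (complexBetti.map e.inv 2 θ) ∧ complexBetti.map e.inv (2 * 3) w ∈ 𝔖 X' (complexBetti.map e.inv 2 θ))
    (X : SchemeOver ℂ) (hXab : ∃ A : AbelianVariety ℂ, A.dim = 6 ∧ Nonempty (A.X ≅ X))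
    (θ : complexBetti X 2) (hθQ : IsRationalClass θ) (hθH : IsOfHodgeType 6 X 2 1 1 θ) (hanc : 𝔄 X θ)
    (w : complexBetti X (2 * 3)) (hw𝔖 : w ∈ 𝔖 X θ) (hwQ : IsRationalClass w) (hwalg : w ∈ algebraicClasses X 3)
    (hwD : w ∉ divisorClassesSpan X 6 3) :
    ∃ (X' : SchemeOver ℂ) (e : X' ≅ X) (I : Finset ℕ) (κ : (q : ℕ) → complexBetti X' (2 * q)) (a : ℂ) (z : complexBetti X (2 * 3)),
      3 ∈ I ∧ Literature.AlgebraicGeometry.HodgeTheory.twistedReflexiveClass C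
        (fun n X₀ I E => Summit.Ventures.HSemireg.gluableSigmaAdmissible n X₀ I E ∨
          Literature.AlgebraicGeometry.HodgeTheory.bfSingleAdmissible n X₀ I E) 6 X' I κ ∧ a ≠ 0 ∧
      z ∈ algebraicClasses X 3 ∧ z ∈ divisorClassesSpan X 6 3 ∧
      κ 3 = complexBetti.map e.hom (2 * 3) (a • w + z) ∧ ∀ q ∈ I, IsOfHodgeType 6 X' (2 * q) q q (κ q) :=
  exists_designModLefschetz_at_anchor_of_under_hasServedFibre h htr X hXab θ hθQ hθH hanc w hw𝔖 hwQ hwalg hwD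

/-- **Non-vacuity of the `(6,3)` partition**: one anchor sixfold (transportable anchor data, `θ` rational `(1,1)`) with a served rational
algebraic class off `D³ ⊗ ℂ` gives a sixfold pencil of the cell's shape in regime 2 WITH a served fibre — so the through-anchor piece asserts
something and the residual excludes something. [cite: Hartshorne1977, II.3 (p. 89)] [cite: vanGeemen1994HodgeAV, §2.4 and Thm. 4.11] -/
theorem not_forall_not_hasServedFibre_63_of_anchor
    {𝔄 : ∀ X : SchemeOver ℂ, complexBetti X 2 → Prop} {𝔖 : ∀ X : SchemeOver ℂ, complexBetti X 2 → Set (complexBetti X (2 * 3))}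
    (htr : ∀ ⦃X X' : SchemeOver ℂ⦄ (e : X ≅ X') (θ : complexBetti X 2) (w : complexBetti X (2 * 3)), 𝔄 X θ → w ∈ 𝔖 X θ →
      𝔄 X' (complexBetti.map e.inv 2 θ) ∧ complexBetti.map e.inv (2 * 3) w ∈ 𝔖 X' (complexBetti.map e.inv 2 θ))
    (X : SchemeOver ℂ) (hXab : ∃ A : AbelianVariety ℂ, A.dim = 6 ∧ Nonempty (A.X ≅ X))
    (θ : complexBetti X 2) (hθQ : IsRationalClass θ) (hθH : IsOfHodgeType 6 X 2 1 1 θ) (hanc : 𝔄 X θ)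
    (w : complexBetti X (2 * 3)) (hw𝔖 : w ∈ 𝔖 X θ) (hwQ : IsRationalClass w) (hwalg : w ∈ algebraicClasses X 3)
    (hwD : w ∉ divisorClassesSpan X 6 3) :
    ¬ ∀ ⦃𝒳 S : SchemeOver ℂ⦄ (f : 𝒳 ⟶ S) (W : complexBetti 𝒳 (2 * 3)), IsSmoothProjectiveFamily f 6 →
      (∀ s : ComplexPoints S, ∃ A' : AbelianVariety ℂ, A'.dim = 6 ∧ Nonempty (A'.X ≅ fiberOver f s)) →
      (¬ ∀ s : ComplexPoints S,
        complexBetti.map (fiberι f s) (2 * 3) W ∈ algebraicClasses (fiberOver f s) 3 ∧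
        complexBetti.map (fiberι f s) (2 * 3) W ∈ divisorClassesSpan (fiberOver f s) 6 3) →
      ¬ HasServedFibre 6 3 𝔄 𝔖 f W :=
  not_forall_not_hasServedFibre_of_anchor htr X hXab θ hθQ hθH hanc w hw𝔖 hwQ hwalg hwD

/-! ## §4 Cell-free: door ∧ anchored carrier at `(6,3)` ⟹ algebraicity on every sixfold pencil through a served anchor (appended) -/

/-- **THE ROUTE BINDER `TwistedPerfectDoor` AND AN ANCHORED CARRIER STATEMENT AT `(6,3)` MAKE EVERY FIBREWISE RATIONAL `(3,3)` CLASS ON EVERY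
SIXFOLD PENCIL THROUGH A SERVED ANCHOR ALGEBRAIC ON EVERY FIBRE** (smooth projective family of relative dimension `6`, quasi-projective total
space, smooth irreducible affine curve base; NO abelian, section, regime or residual hypothesis; per Chern character theory `C`). With
`𝔄 C :=` Markman's secant anchors and `𝔖 C :=` their served classes this is the kernel form of arXiv:2502.03415 Thm. 1.5.1's mechanism
(algebraicity on the whole Weil locus through the anchor), the carrier statement being skeleton v3's `stub_anchorCarrier_63`.
[cite: Markman2025SecantWeil, Thm. 1.4.1 and Thm. 1.5.1] [cite: Pridham2024Semiregularity, Cor. 2.25 and Rem. 2.27]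
[cite: CharlesSchnell2014Notes, Prop. 11.3.11 (proof)] -/
theorem mem_algebraicClasses_of_twistedPerfectDoor_of_anchoredCarrierAt_63
    (hDoor : Theses.VHCAbelianSchemesRoad.TwistedPerfectDoor)
    (𝔄 : ChernCharacterBetti → ∀ X : SchemeOver ℂ, complexBetti X 2 → Prop)
    (𝔖 : ChernCharacterBetti → ∀ X : SchemeOver ℂ, complexBetti X 2 → Set (complexBetti X (2 * 3)))
    (hA : ∀ C : ChernCharacterBetti,
      AnchoredCarrierAt (Literature.AlgebraicGeometry.HodgeTheory.twistedReflexiveClass C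
        (fun n X₀ I E => Summit.Ventures.HSemireg.gluableSigmaAdmissible n X₀ I E ∨
          Literature.AlgebraicGeometry.HodgeTheory.bfSingleAdmissible n X₀ I E)) 6 3 (𝔄 C) (𝔖 C))
    (C : ChernCharacterBetti) {𝒳 S : SchemeOver ℂ} {f : 𝒳 ⟶ S} (hf : IsSmoothProjectiveFamily f 6) (h𝒳 : IsQuasiProjectiveOver 𝒳)
    (hirr : IrreducibleSpace S.left) (haff : IsAffine S.left) (hsm : AlgebraicGeometry.Smooth S.hom)
    (hdim : topologicalKrullDim S.left = 1) (W : complexBetti 𝒳 (2 * 3))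
    (hW : ∀ s : ComplexPoints S, IsRationalClass (complexBetti.map (fiberι f s) (2 * 3) W) ∧
      IsOfHodgeType 6 (fiberOver f s) (2 * 3) 3 3 (complexBetti.map (fiberι f s) (2 * 3) W))
    (hsf : HasServedFibre 6 3 (𝔄 C) (𝔖 C) f W) (s : ComplexPoints S) :
    complexBetti.map (fiberι f s) (2 * 3) W ∈ algebraicClasses (fiberOver f s) 3 :=
  mem_algebraicClasses_of_twistedPerfectDoorVHC_of_anchoredCarrierAt (hDoor C) (hA C) hf h𝒳 hirr haff hsm hdim W hW hsf s

/-- **… and on every sixfold ISOMORPHIC TO A FIBRE of such a pencil**: a rational `(3,3)` class `w` on `X ≅ 𝒳_s` matching `W|_s` is algebraic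
(the per-variety form: HC in codimension `3` for the sixfolds REACHABLE from a served anchor). [cite: Markman2025SecantWeil, Thm. 1.5.1]
[cite: CharlesSchnell2014Notes, Prop. 11.3.11 (proof)] -/
theorem mem_algebraicClasses_of_twistedPerfectDoor_of_anchoredCarrierAt_63_through
    (hDoor : Theses.VHCAbelianSchemesRoad.TwistedPerfectDoor)
    (𝔄 : ChernCharacterBetti → ∀ X : SchemeOver ℂ, complexBetti X 2 → Prop)
    (𝔖 : ChernCharacterBetti → ∀ X : SchemeOver ℂ, complexBetti X 2 → Set (complexBetti X (2 * 3)))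
    (hA : ∀ C : ChernCharacterBetti,
      AnchoredCarrierAt (Literature.AlgebraicGeometry.HodgeTheory.twistedReflexiveClass C
        (fun n X₀ I E => Summit.Ventures.HSemireg.gluableSigmaAdmissible n X₀ I E ∨
          Literature.AlgebraicGeometry.HodgeTheory.bfSingleAdmissible n X₀ I E)) 6 3 (𝔄 C) (𝔖 C))
    (C : ChernCharacterBetti) {𝒳 S : SchemeOver ℂ} {f : 𝒳 ⟶ S} (hf : IsSmoothProjectiveFamily f 6) (h𝒳 : IsQuasiProjectiveOver 𝒳)
    (hirr : IrreducibleSpace S.left) (haff : IsAffine S.left) (hsm : AlgebraicGeometry.Smooth S.hom)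
    (hdim : topologicalKrullDim S.left = 1) (W : complexBetti 𝒳 (2 * 3))
    (hW : ∀ s : ComplexPoints S, IsRationalClass (complexBetti.map (fiberι f s) (2 * 3) W) ∧
      IsOfHodgeType 6 (fiberOver f s) (2 * 3) 3 3 (complexBetti.map (fiberι f s) (2 * 3) W))
    (hsf : HasServedFibre 6 3 (𝔄 C) (𝔖 C) f W) {X : SchemeOver ℂ} {s : ComplexPoints S} (e : X ≅ fiberOver f s)
    (w : complexBetti X (2 * 3)) (hw : complexBetti.map e.inv (2 * 3) w = complexBetti.map (fiberι f s) (2 * 3) W) :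
    w ∈ algebraicClasses X 3 :=
  mem_algebraicClasses_of_anchoredCarrierAt_of_servedPencil_through
    ((twistedPerfectDoorVHC_iff_localVariationalHodgeFor C _).1 (hDoor C)) (hA C) hf h𝒳 hirr haff hsm hdim W hW hsf e w hw


end Summit.HodgeConjecture.HodgeConjecture.Ring2.SemiregularRepresentatives

end
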